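import Mathlib
import HarnessLib
import Summits.HubbardSuperconductivity.HubbardSuperconductivity.Theorems.KLProgrammeKLRegimeEngineV8E5CarrierSplit
import Summits.HubbardSuperconductivity.HubbardSuperconductivity.Theorems.KLProgrammeKLRegimeEngineV8E5CarrierBlockStep
import Summits.HubbardSuperconductivity.HubbardSuperconductivity.Theorems.KLProgrammeKLRegimeEngineV8E5SliceRowsDefs

/-!
# Route `KLProgramme` — ENGINE child gen 8 (stmt-HubbardSuperconductivity-20437 `KLRegimeEngineV17F2`), SKELETON v2 class #3, (RA-U) SUPPLIER part 3b-i: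
# the three one-step doors AT THE (R1′) OBJECTS of the carrier's four-term split, every LINE datum discharged
# (cell gate-hubbard-kl, seat p5 g11; pen (R71e)/(R71g); memo RA-U-SUPPLY §5–§6; form-agnostic w.r.t. E1's (RA-U-a′) word)

`hubbardSectorKernelNorm_klE5Carrier_le_four` (…E5CarrierSplit §4) splits the (R1′) carrier `W_Λ` of the step `n−1 → n` at the frame `K_n` into
`V + (e^{Δ_{C∞}}V − V) + I_Λ + (e^{Δ_D}I_Λ − I_Λ)`, `V = klE5Input … (n−1)`, `C∞ = klE5Total`, `C_Λ = klE5DressedSlice … Λ`, `D = C∞ − C_Λ`,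
`I_Λ = effAction C_Λ V − e^{Δ_{C_Λ}}V`.  This file applies the prescribed one-step doors at the carrier geometry (…E5CarrierBlockStep §2/§3) to the three
born terms WITH THE MODEL'S LINES, discharging every line hypothesis from the landed line theory: the symbol identities
(`klE5Total_eq_normalCovariance`, `klE5Total_sub_dressedSlice_eq_normalCovariance`, `klE5DressedSlice = normalCovariance (s/(1+sκ))`), the supports
`ρ_K ≤ Λ_{n−1}` and soft shapes `A_p = 10 / 8 / 2` under the dressing smallness (…E5CarrierLines §5), the Gram data on the point-augmented fat family from
k3c2-p2's package (`gram_softShaped_pointAugmentFat_klEng`, …E5CarrierLines §6), parity / constant part of the inputs (…E5CarrierSplit §1/§3):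

* §1 **`carrier_smearTotal_firstOrder_le`** — term 2: the binomial door for `e^{Δ_{C∞}}V − V`, input family = point-augmented level `n−3`, output level `n−2`,
  Gram constant `√(10·Cκ·e₀·8^{−(n−3)})`; REMAINING inputs: the prescribed sizes `B` of `V` at the input family (= input (a), E1's (RA-U-a′) read-out of
  `𝒱_{n−1}[K_n]` at level `n−3`, cf. `hubbardSectorKernelNorm_klE5Input_of_ne_two`) and the overlap rows `(cr, cc)` of `E(F⁺_{n−2})·S(F̃⁺_{n−3})`;
* §2 **`carrier_increment_ordersGe2_le`** — term 3 (and the input sizes of term 4): the graded door for `I_Λ`, input level `n−4`, output level `J′ ≥ n−3`,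
  Gram constant `√(2·Cκ·e₀·8^{−(n−4)})`, rows `α` = the (b) datum `E5SliceRowsAt … Λ (n−4) α` TRANSFERRED to the augmented family; REMAINING inputs: `B` of
  `V` at level `n−4`, `(cr, cc)`, the kit parameters `ρ`, `θ < 1`, `N₀`, and `Z^{K_n}_{Λ_{n−1}} ≠ 0`;
* §3 **`carrier_smearSoft_firstOrder_le`** — term 4: the binomial door for `e^{Δ_D}I_Λ − I_Λ`, input level `n−3`, output level `n−2`, Gram constant
  `√(8·Cκ·e₀·8^{−(n−3)})`; REMAINING inputs: the prescribed sizes `B_I` of `I_Λ` at level `n−3` (= §2 read at `J′ = n−3`, summed by E1's kit in part 4),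
  `(cr, cc)`, `Z ≠ 0`.
Binders = EXACTLY those of `gram_softShaped_pointAugmentFat_klEng` (doors `klEngC₃3`, `klEngU₀4`, `klEngL₃`, `klEngM₃` — the stub binders are stronger) plus
`FrameOK … (K_n)`, `Λ ∈ [Λ_n, Λ_{n−1}]`, the (SM) row of `exists_e5Pkg2_of_rows`.  One absolute `Cκ > 0` (k3c2-p2's) serves all three.
Pure composition of landed theorems; no definitions, no named facts, nothing about the model's sizes is asserted; nothing asserts superconductivity.
-/

noncomputable section

namespace Summit.HubbardSuperconductivity.HubbardSuperconductivity.Theorems.KLRegimeSplit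

set_option linter.dupNamespace false -- summit = problem name (single-conjunct summit), D-0017

open Real Finset Literature.MathematicalPhysics.QuantumLattice Literature.Probability.LatticeModels GrassmannAlgebra Matrix
open Literature.MathematicalPhysics.QuantumLattice.FermiRG
open Summit.HubbardSuperconductivity.HubbardSuperconductivity.Theorems.KLProgrammeLegKernels
open Summit.HubbardSuperconductivity.HubbardSuperconductivity.Theorems.KLRegimeWick
open Summit.HubbardSuperconductivity.HubbardSuperconductivity.Theorems.EngineV8
open Summit.HubbardSuperconductivity.HubbardSuperconductivity.Theorems.TwoPointAssembly
open Summit.HubbardSuperconductivity.HubbardSuperconductivity.Theorems.TorusFourierL2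
open Summit.HubbardSuperconductivity.HubbardSuperconductivity.Theorems.DispersionFlow

/-! ## §1 Term 2: the input smeared by the total covariance, first order -/

/-- **TERM 2 OF THE CARRIER SPLIT — `e^{Δ_{C∞}}V − V` through the binomial prescribed door, all line data discharged.**  At the step `n−1 → n` (`4 ≤ n`),
frame `K_n`, cutoff `Λ ∈ [Λ_n, Λ_{n−1}]`, under the dressing smallness at `Λ_n` and `Λ`: the total covariance `C∞ = klE5Total` is the normal covariance of a
symbol supported in `{ρ_K ≤ Λ_{n−1}}` of soft shape `A_p = 10`, so the first-order door at the carrier geometry applies with input pair = the point-augmented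
families of level `n−3`, output = level `n−2`, Gram constant `√(10·Cκ·e₀·8^{−(n−3)})`; the input `V = klE5Input … (n−1)` is even.  Remaining hypotheses: the
prescribed input sizes `B` of `V` at level `n−3` (input (a)) and the overlap rows `(cr, cc)`. [cite: BenfattoGiulianiMastropietro2006, §2.8 (2.80)] -/
theorem carrier_smearTotal_firstOrder_le :
    ∃ Cκ : ℝ, 0 < Cκ ∧ ∀ (P : SplitConsts) (R : RenConsts) (c : ℝ), P.WF → R.WF2 → 0 < c → c ≤ klEngC₃3 P R →
      ∀ μ ∈ klWindowC, ∀ U : ℝ, 0 < U → U ≤ klEngU₀4 P R c → ∀ β : ℝ, klBetaMin ≤ β → β ≤ Real.exp (c / U ^ 2) →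
      ∀ (L M : ℕ) [NeZero L] [NeZero M], klEngL₃ β U ≤ L → klEngM₃ β U L ≤ M →
      ∀ n : ℕ, 4 ≤ n → n ≤ nScales β + 1 → FrameOK R U (nScales β) μ (klFlowFrameU L M β U μ n) →
      ∀ Λ ∈ Set.Icc (klScale klE0 n) (klScale klE0 (n - 1)),
      (∀ ks : FreqMomentum L M × Fin 2,
        ‖klE5SliceSym L M β μ (klFlowFrameU L M β U μ n) (n - 1) (klScale klE0 n) ks * klE5Kappa L M β U μ (klFlowFrameU L M β U μ n) (n - 1) ks‖ ≤ 1 / 2 ∧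
        ‖klE5SliceSym L M β μ (klFlowFrameU L M β U μ n) (n - 1) Λ ks * klE5Kappa L M β U μ (klFlowFrameU L M β U μ n) (n - 1) ks‖ ≤ 1 / 2) →
      ∀ (Qm : TorusSite 2 L) (x y : TorusSite 2 L × MatsubaraIdx M) (B : ℕ → ℕ → ℝ), (∀ m' Fc, 0 ≤ B m' Fc) →
      (∀ (m' Fc : ℕ) (E : Finset (Fin (2 * m' + 1 + 1))) (τ : Fin (2 * m' + 1 + 1) → SectorLeg (sectorCount (n - 3) + 4))
        (q : Fin (2 * m' + 1 + 1)), q ∈ E → E.card = Fc + 1 → ∀ ys : SpaceTimeIdx L M,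
          imagTimeWeight β M ^ (2 * m' + 1) *
            ∑ σ ∈ univ.filter (fun σ : Fin (2 * m' + 1 + 1) → SectorLeg (sectorCount (n - 3) + 4) => ∀ e ∈ E, σ e = τ e),
              ∑ xs ∈ univ.filter (fun xs : Fin (2 * m' + 1 + 1) → SpaceTimeIdx L M => xs q = ys),
                ‖sectorisedKernel L M β (pointAugment (klAnisoFamily L M β μ (klFlowFrameU L M β U μ n) klE0 (n - 3)) (klE5ExtMomenta Qm x y))
                  (klE5Input L M β U μ (klFlowFrameU L M β U μ n) (n - 1)) (2 * m' + 1 + 1) σ xs‖ ≤ B (m' + 1) Fc) →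
      ∀ {cr cc : ℝ}, 0 ≤ cc →
      (∀ X'', ∑ X', ‖(sectorAnalysisMatrix L M β (pointAugment (klAnisoFamily L M β μ (klFlowFrameU L M β U μ n) klE0 (n - 2)) (klE5ExtMomenta Qm x y)) *
          sectorSubMatrix L M β (pointAugmentFat (klAnisoFamily L M β μ (klFlowFrameU L M β U μ n) klE0 (n - 3))
            (bgmFatMultiplier L M klE0 β (nambuXiCT L μ (klFlowFrameU L M β U μ n)) (n - 3)) (klE5ExtMomenta Qm x y))) X'' X'‖ ≤ cr) →
      (∀ X', ∑ X'', ‖(sectorAnalysisMatrix L M β (pointAugment (klAnisoFamily L M β μ (klFlowFrameU L M β U μ n) klE0 (n - 2)) (klE5ExtMomenta Qm x y)) *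
          sectorSubMatrix L M β (pointAugmentFat (klAnisoFamily L M β μ (klFlowFrameU L M β U μ n) klE0 (n - 3))
            (bgmFatMultiplier L M klE0 β (nambuXiCT L μ (klFlowFrameU L M β U μ n)) (n - 3)) (klE5ExtMomenta Qm x y))) X'' X'‖ ≤ cc) →
      ∀ {q : ℕ} (i : Fin (2 * q + 1 + 1)) (J : Finset (Fin (2 * q + 1 + 1))), i ∉ J →
      ∀ (τ'' : Fin (2 * q + 1 + 1) → SectorLeg (sectorCount (n - 2) + 4)) (w'' : SpaceTimeIdx L M × SectorLeg (sectorCount (n - 2) + 4)),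
      ∑ X'' ∈ univ.filter (fun X'' : Fin (2 * q + 1 + 1) → SpaceTimeIdx L M × SectorLeg (sectorCount (n - 2) + 4) =>
          X'' i = w'' ∧ ∀ j ∈ J, (X'' j).2 = τ'' j),
        ‖kernel ℂ (ExteriorAlgebra.map (Matrix.toLin' (sectorAnalysisMatrix L M β
            (pointAugment (klAnisoFamily L M β μ (klFlowFrameU L M β U μ n) klE0 (n - 2)) (klE5ExtMomenta Qm x y))))
          (gaussConv ℂ (klE5Total L M β μ (klFlowFrameU L M β U μ n) (n - 1) (klE5Kappa L M β U μ (klFlowFrameU L M β U μ n) (n - 1)))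
              (klE5Input L M β U μ (klFlowFrameU L M β U μ n) (n - 1)) -
            klE5Input L M β U μ (klFlowFrameU L M β U μ n) (n - 1))) (2 * q + 1 + 1) X''‖ ≤
      cr * cc ^ (2 * q + 1) *
        ∑ m' ∈ range (Fintype.card (SpaceTimeIdx L M × SectorLeg (sectorCount (n - 3) + 4)) / 2 + 1), (if q + 1 < m' then
          ((((2 * (q + 1)).factorial : ℝ))⁻¹ * ((∏ j ∈ univ.filter (fun j : Fin (2 * (q + 1)) => j ∉ J), (2 * m' - (j : ℕ)) : ℕ) : ℝ)) *
            ((2 * m' : ℕ) : ℝ) ^ J.card * Real.sqrt (10 * Cκ * (klE0 * ((8 : ℝ) ^ (n - 3))⁻¹)) ^ (2 * m' - 2 * (q + 1)) *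
              (((36 + 4 : ℕ) : ℝ) ^ J.card * (imagTimeWeight β M * B m' J.card)) else 0) := by
  obtain ⟨Cκ, hCκ, hpkg⟩ := gram_softShaped_pointAugmentFat_klEng
  refine ⟨Cκ, hCκ, ?_⟩
  intro P R c hP hR hc hc3 μ hμ U hU hU4 β hβ hβc L M _ _ hL hM n hn4 hnN hF Λ hΛ hsm Qm x y B hB0 hB cr cc hcc0 hrow' hcol' q i J hi τ'' w''
  -- abbreviations
  set K := klFlowFrameU L M β U μ n with hK
  set κ := klE5Kappa L M β U μ K (n - 1) with hκ
  set e := klE5ExtMomenta (L := L) (M := M) Qm x y with he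
  set p : FreqMomentum L M × Fin 2 → ℂ := fun ks => klE5SoftLineSym L M β μ K (n - 1) κ Λ ks +
      klE5SliceSym L M β μ K (n - 1) Λ ks / (1 + klE5SliceSym L M β μ K (n - 1) Λ ks * κ ks) with hp
  have he₀ : (0 : ℝ) ≤ klE0 := by norm_num [klE0]
  have hβ0 : 0 < β := lt_of_lt_of_le (by norm_num [klBetaMin]) hβ
  have hn1 : n - 1 + 1 = n := by omega
  have hΛpos : 0 < Λ := lt_of_lt_of_le (klth_klScale_pos n) hΛ.1
  -- the total symbol: soft shape `A_p = 10` and support `ρ_K ≤ Λ_{n−1}`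
  have hshape : ∀ ks, p ks ≠ 0 → ‖p ks‖ ≤ 10 * (β * (L : ℝ) ^ 2) / Real.sqrt (matsubaraFreq β M ks.1.1 ^ 2 + nambuXiCT L μ K ks.1.2 ^ 2) := by
    intro ks _
    have h1 : ‖klE5SliceSym L M β μ K (n - 1) (klScale klE0 (n - 1 + 1)) ks * κ ks‖ ≤ 1 / 2 := by rw [hn1]; exact (hsm ks).1
    exact norm_klE5TotalSym_le_div_radius β μ K (n - 1) κ hβ0.le ks h1 (hsm ks).2
  have hsupp : ∀ ks, p ks ≠ 0 → Real.sqrt (matsubaraFreq β M ks.1.1 ^ 2 + nambuXiCT L μ K ks.1.2 ^ 2) ≤ klScale klE0 (n - 1) :=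
    fun ks hks => klRadius_le_of_klE5TotalSym_ne_zero β μ K (n - 1) κ hΛpos hΛ.2 ks hks
  have hsuppPkg : ∀ ks, p ks ≠ 0 → Real.sqrt (matsubaraFreq β M ks.1.1 ^ 2 + nambuXiCT L μ K ks.1.2 ^ 2) ≤ klScale klE0 (n - 3 + 1) :=
    fun ks hks => (hsupp ks hks).trans (klScale_le_klScale he₀ (by omega))
  have hsuppDoor : ∀ ks, p ks ≠ 0 → Real.sqrt (matsubaraFreq β M ks.1.1 ^ 2 + nambuXiCT L μ K ks.1.2 ^ 2) ≤ klScale klE0 (n - 2) :=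
    fun ks hks => (hsupp ks hks).trans (klScale_le_klScale he₀ (by omega))
  -- the Gram datum on the point-augmented fat family of level `n−3`
  obtain ⟨-, -, -, hGB, -⟩ := hpkg P R c hP hR hc hc3 μ hμ U hU hU4 β hβ hβc K hF L M hL hM (n - 3) (by omega) (by omega) p 10 (by norm_num)
    hshape hsuppPkg e
  -- the identity `C∞ = normalCovariance p` and the parity of the input
  have hC : klE5Total L M β μ K (n - 1) κ = normalCovariance L M p := klE5Total_eq_normalCovariance β μ K (n - 1) κ Λ
  have hV : klE5Input L M β U μ K (n - 1) ∈ evenPart ℂ (HubbardFieldIdx L M) := klE5Input_mem_evenPart β U μ K (n - 1) hβ0.ne'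
  rw [hC]
  exact carrierStep_firstOrder_lev_le hβ0 μ K (J₁ := n - 2) (J' := n - 2) (by omega) le_rfl e p hsuppDoor _ hV (Real.sqrt_nonneg _) hGB
    B hB0 hB hcc0 hrow' hcol' i J hi τ'' w''

/-! ## §2 Term 3: the orders-≥-2 increment of the dressed partial slice, graded -/

/-- **TERM 3 OF THE CARRIER SPLIT — `I_Λ = effAction C_Λ V − e^{Δ_{C_Λ}}V` through the graded prescribed door, all line data discharged** (`C_Λ =
klE5DressedSlice … Λ = normalCovariance (s_Λ/(1+s_Λκ))`, soft shape `A_p = 2`, support `{ρ_K ≤ Λ_{n−1}}`; input pair = point-augmented level `n−4` (`5 ≤ n`),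
output level `J′ ≥ n−3` — `J′ = n−2` for the term itself, `J′ = n−3` for the input sizes of term 4; Gram constant `√(2·Cκ·e₀·8^{−(n−4)})`; rows/columns
`α > 0` = the (b) datum `E5SliceRowsAt … Λ (n−4) α` on the PLAIN fat family, transferred to the point-augmented one by `gram_softShaped_pointAugmentFat_klEng`;
`V` even and constant-free, `Z^{K_n}_{Λ_{n−1}} ≠ 0`).  Remaining hypotheses: the prescribed sizes `B` of `V` at level `n−4` (input (a)), the kit parameters
`ρ > 0`, `θ < 1`, `N₀ ≥ 2`, and the overlap rows `(cr, cc)` of `E(F⁺_{J′})·S(F̃⁺_{n−4})`. [cite: BenfattoGiulianiMastropietro2006, §2.8 (2.82)-(2.84); Lemma 2.5 (2.98)] -/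
theorem carrier_increment_ordersGe2_le :
    ∃ Cκ : ℝ, 0 < Cκ ∧ ∀ (P : SplitConsts) (R : RenConsts) (c : ℝ), P.WF → R.WF2 → 0 < c → c ≤ klEngC₃3 P R →
      ∀ μ ∈ klWindowC, ∀ U : ℝ, 0 < U → U ≤ klEngU₀4 P R c → ∀ β : ℝ, klBetaMin ≤ β → β ≤ Real.exp (c / U ^ 2) →
      ∀ (L M : ℕ) [NeZero L] [NeZero M], klEngL₃ β U ≤ L → klEngM₃ β U L ≤ M →
      ∀ n : ℕ, 5 ≤ n → n ≤ nScales β + 1 → FrameOK R U (nScales β) μ (klFlowFrameU L M β U μ n) →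
      hubbardEffPartitionFnCT L M β U μ 0 (klFlowFrameU L M β U μ n) (klScale klE0 (n - 1)) ≠ 0 →
      ∀ Λ ∈ Set.Icc (klScale klE0 n) (klScale klE0 (n - 1)),
      (∀ ks : FreqMomentum L M × Fin 2, ‖klE5SliceSym L M β μ (klFlowFrameU L M β U μ n) (n - 1) Λ ks * klE5Kappa L M β U μ (klFlowFrameU L M β U μ n) (n - 1) ks‖ ≤ 1 / 2) →
      ∀ (Qm : TorusSite 2 L) (x y : TorusSite 2 L × MatsubaraIdx M) {J' : ℕ}, n - 3 ≤ J' →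
      ∀ {α : ℝ}, 0 < α → E5SliceRowsAt L M β μ (klFlowFrameU L M β U μ n) (n - 1) (klE5Kappa L M β U μ (klFlowFrameU L M β U μ n) (n - 1)) Λ (n - 4) α →
      ∀ (B : ℕ → ℕ → ℝ), (∀ m' Fc, 0 ≤ B m' Fc) →
      (∀ (m' Fc : ℕ) (E : Finset (Fin (2 * m' + 1 + 1))) (τ : Fin (2 * m' + 1 + 1) → SectorLeg (sectorCount (n - 4) + 4))
        (q : Fin (2 * m' + 1 + 1)), q ∈ E → E.card = Fc + 1 → ∀ ys : SpaceTimeIdx L M,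
          imagTimeWeight β M ^ (2 * m' + 1) *
            ∑ σ ∈ univ.filter (fun σ : Fin (2 * m' + 1 + 1) → SectorLeg (sectorCount (n - 4) + 4) => ∀ e ∈ E, σ e = τ e),
              ∑ xs ∈ univ.filter (fun xs : Fin (2 * m' + 1 + 1) → SpaceTimeIdx L M => xs q = ys),
                ‖sectorisedKernel L M β (pointAugment (klAnisoFamily L M β μ (klFlowFrameU L M β U μ n) klE0 (n - 4)) (klE5ExtMomenta Qm x y))
                  (klE5Input L M β U μ (klFlowFrameU L M β U μ n) (n - 1)) (2 * m' + 1 + 1) σ xs‖ ≤ B (m' + 1) Fc) →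
      ∀ {ρ : ℝ}, 0 < ρ →
      Real.exp 1 * α * normV (SpaceTimeIdx L M × SectorLeg (sectorCount (n - 4) + 4)) (Real.sqrt (2 * Cκ * (klE0 * ((8 : ℝ) ^ (n - 4))⁻¹))) ρ
              (fun m' => ((36 + 4 : ℕ) : ℝ) ^ 0 * (imagTimeWeight β M * B m' 0)) / Real.sqrt (2 * Cκ * (klE0 * ((8 : ℝ) ^ (n - 4))⁻¹)) ^ 2 < 1 →
      ∀ {cr cc : ℝ}, 0 ≤ cc →
      (∀ X'', ∑ X', ‖(sectorAnalysisMatrix L M β (pointAugment (klAnisoFamily L M β μ (klFlowFrameU L M β U μ n) klE0 J') (klE5ExtMomenta Qm x y)) *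
          sectorSubMatrix L M β (pointAugmentFat (klAnisoFamily L M β μ (klFlowFrameU L M β U μ n) klE0 (n - 4)) (bgmFatMultiplier L M klE0 β (nambuXiCT L μ (klFlowFrameU L M β U μ n)) (n - 4)) (klE5ExtMomenta Qm x y))) X'' X'‖ ≤ cr) →
      (∀ X', ∑ X'', ‖(sectorAnalysisMatrix L M β (pointAugment (klAnisoFamily L M β μ (klFlowFrameU L M β U μ n) klE0 J') (klE5ExtMomenta Qm x y)) *
          sectorSubMatrix L M β (pointAugmentFat (klAnisoFamily L M β μ (klFlowFrameU L M β U μ n) klE0 (n - 4)) (bgmFatMultiplier L M klE0 β (nambuXiCT L μ (klFlowFrameU L M β U μ n)) (n - 4)) (klE5ExtMomenta Qm x y))) X'' X'‖ ≤ cc) →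
      ∀ {N₀ : ℕ}, 2 ≤ N₀ → ∀ {m : ℕ} (p_1 : Fin (m + 1)) (J : Finset (Fin (m + 1))), p_1 ∉ J →
      ∀ (τ'' : Fin (m + 1) → SectorLeg (sectorCount J' + 4)) (w'' : SpaceTimeIdx L M × SectorLeg (sectorCount J' + 4)),
      ∑ X'' ∈ univ.filter (fun X'' : Fin (m + 1) → SpaceTimeIdx L M × SectorLeg (sectorCount J' + 4) => X'' p_1 = w'' ∧ ∀ j ∈ J, (X'' j).2 = τ'' j),
        ‖kernel ℂ (ExteriorAlgebra.map (Matrix.toLin' (sectorAnalysisMatrix L M β (pointAugment (klAnisoFamily L M β μ (klFlowFrameU L M β U μ n) klE0 J') (klE5ExtMomenta Qm x y))))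
          (effAction ℂ (klE5DressedSlice L M β μ (klFlowFrameU L M β U μ n) (n - 1) (klE5Kappa L M β U μ (klFlowFrameU L M β U μ n) (n - 1)) Λ) (klE5Input L M β U μ (klFlowFrameU L M β U μ n) (n - 1)) -
            gaussConv ℂ (klE5DressedSlice L M β μ (klFlowFrameU L M β U μ n) (n - 1) (klE5Kappa L M β U μ (klFlowFrameU L M β U μ n) (n - 1)) Λ) (klE5Input L M β U μ (klFlowFrameU L M β U μ n) (n - 1)))) (m + 1) X''‖ ≤
      cr * cc ^ m *
        (∑ n' ∈ Ico 2 N₀, ((Real.sqrt (2 * Cκ * (klE0 * ((8 : ℝ) ^ (n - 4))⁻¹)))⁻¹ ^ (m + 1) * (Real.sqrt (2 * Cκ * (klE0 * ((8 : ℝ) ^ (n - 4))⁻¹)))⁻¹ ^ (2 * (n' - 1)) * (α ^ (n' - 1) * Real.exp n')) *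
            ∑ δ ∈ (Fintype.piFinset fun _ : Fin n' => range (Fintype.card (SpaceTimeIdx L M × SectorLeg (sectorCount (n - 4) + 4)) / 2 + 1)) with
                m + 1 + 2 * (n' - 1) ≤ ∑ a, 2 * δ a,
              ∑ pf : J → Fin n', ((∏ j, ((2 * δ (pf j) : ℕ) : ℝ)) / ((∑ a, 2 * δ a : ℕ) : ℝ) ^ J.card) *
                ∏ a, (Real.exp 3 * Real.sqrt (2 * Cκ * (klE0 * ((8 : ℝ) ^ (n - 4))⁻¹))) ^ (2 * δ a) *
                  (((36 + 4 : ℕ) : ℝ) ^ (univ.filter fun j : J => pf j = a).card *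
                    (imagTimeWeight β M * B (δ a) (univ.filter fun j : J => pf j = a).card)) +
          ρ⁻¹ ^ (m + 1) * (Real.exp 1 * normV (SpaceTimeIdx L M × SectorLeg (sectorCount (n - 4) + 4)) (Real.sqrt (2 * Cκ * (klE0 * ((8 : ℝ) ^ (n - 4))⁻¹))) ρ
              (fun m' => ((36 + 4 : ℕ) : ℝ) ^ 0 * (imagTimeWeight β M * B m' 0))) *
            (Real.exp 1 * α * normV (SpaceTimeIdx L M × SectorLeg (sectorCount (n - 4) + 4)) (Real.sqrt (2 * Cκ * (klE0 * ((8 : ℝ) ^ (n - 4))⁻¹))) ρ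
              (fun m' => ((36 + 4 : ℕ) : ℝ) ^ 0 * (imagTimeWeight β M * B m' 0)) / Real.sqrt (2 * Cκ * (klE0 * ((8 : ℝ) ^ (n - 4))⁻¹)) ^ 2) ^ (N₀ - 1) /
            (1 - Real.exp 1 * α * normV (SpaceTimeIdx L M × SectorLeg (sectorCount (n - 4) + 4)) (Real.sqrt (2 * Cκ * (klE0 * ((8 : ℝ) ^ (n - 4))⁻¹))) ρ
              (fun m' => ((36 + 4 : ℕ) : ℝ) ^ 0 * (imagTimeWeight β M * B m' 0)) / Real.sqrt (2 * Cκ * (klE0 * ((8 : ℝ) ^ (n - 4))⁻¹)) ^ 2)) := by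
  obtain ⟨Cκ, hCκ, hpkg⟩ := gram_softShaped_pointAugmentFat_klEng
  refine ⟨Cκ, hCκ, ?_⟩
  intro P R c hP hR hc hc3 μ hμ U hU hU4 β hβ hβc L M _ _ hL hM n hn5 hnN hF hZ Λ hΛ hsm Qm x y J' hJ' α hα hrows B hB0 hB ρ hρ hθ cr cc hcc0
    hrow' hcol' N₀ hN₀ m p_1 J hp_1 τ'' w''
  -- abbreviations
  set K := klFlowFrameU L M β U μ n with hK
  set κ := klE5Kappa L M β U μ K (n - 1) with hκ
  set e := klE5ExtMomenta (L := L) (M := M) Qm x y with he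
  set V := klE5Input L M β U μ K (n - 1) with hV
  set p : FreqMomentum L M × Fin 2 → ℂ := fun ks => klE5SliceSym L M β μ K (n - 1) Λ ks / (1 + klE5SliceSym L M β μ K (n - 1) Λ ks * κ ks) with hp
  have he₀ : (0 : ℝ) ≤ klE0 := by norm_num [klE0]
  have hβ0 : 0 < β := lt_of_lt_of_le (by norm_num [klBetaMin]) hβ
  have hΛpos : 0 < Λ := lt_of_lt_of_le (klth_klScale_pos n) hΛ.1
  -- the dressed partial-slice symbol: soft shape `A_p = 2` and support `ρ_K ≤ Λ_{n−1}`
  have hshape : ∀ ks, p ks ≠ 0 → ‖p ks‖ ≤ 2 * (β * (L : ℝ) ^ 2) / Real.sqrt (matsubaraFreq β M ks.1.1 ^ 2 + nambuXiCT L μ K ks.1.2 ^ 2) :=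
    fun ks _ => norm_klE5DressedSliceSym_le_div_radius β μ K (n - 1) κ hβ0.le ks (hsm ks)
  have hsupp : ∀ ks, p ks ≠ 0 → Real.sqrt (matsubaraFreq β M ks.1.1 ^ 2 + nambuXiCT L μ K ks.1.2 ^ 2) ≤ klScale klE0 (n - 1) :=
    fun ks hks => klRadius_le_of_klE5DressedSliceSym_ne_zero β μ K (n - 1) κ hΛpos hΛ.2 ks hks
  have hsuppPkg : ∀ ks, p ks ≠ 0 → Real.sqrt (matsubaraFreq β M ks.1.1 ^ 2 + nambuXiCT L μ K ks.1.2 ^ 2) ≤ klScale klE0 (n - 4 + 1) :=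
    fun ks hks => (hsupp ks hks).trans (klScale_le_klScale he₀ (by omega))
  have hsuppDoor : ∀ ks, p ks ≠ 0 → Real.sqrt (matsubaraFreq β M ks.1.1 ^ 2 + nambuXiCT L μ K ks.1.2 ^ 2) ≤ klScale klE0 (n - 3) :=
    fun ks hks => (hsupp ks hks).trans (klScale_le_klScale he₀ (by omega))
  -- the Gram datum and the transferred (b) rows on the point-augmented fat family of level `n−4`
  obtain ⟨-, -, -, hGB, htr⟩ := hpkg P R c hP hR hc hc3 μ hμ U hU hU4 β hβ hβc K hF L M hL hM (n - 4) (by omega) (by omega) p 2 (by norm_num)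
    hshape hsuppPkg e
  obtain ⟨hrow, hcol⟩ := htr α hα.le ((e5SliceRowsAt_iff_normalCovariance β μ K (n - 1) κ Λ (n - 4) α).1 hrows).1
    ((e5SliceRowsAt_iff_normalCovariance β μ K (n - 1) κ Λ (n - 4) α).1 hrows).2
  -- the identity `C_Λ = normalCovariance p`, parity and constant part of the input, positivity of the Gram constant
  have hC : klE5DressedSlice L M β μ K (n - 1) κ Λ = normalCovariance L M p := rfl
  have hVe : V ∈ evenPart ℂ (HubbardFieldIdx L M) := klE5Input_mem_evenPart β U μ K (n - 1) hβ0.ne'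
  have hV0 : constPart ℂ V = 0 := constPart_klE5Input_eq_zero β U μ K (n - 1) hZ
  have hκpos : 0 < Real.sqrt (2 * Cκ * (klE0 * ((8 : ℝ) ^ (n - 4))⁻¹)) :=
    Real.sqrt_pos.2 (by have : (0 : ℝ) < klE0 := by norm_num [klE0]
                        positivity)
  rw [hC]
  exact carrierStep_ordersGe2_lev_le hβ0 μ K (J₁ := n - 3) (J' := J') (by omega) hJ' e p hsuppDoor V hVe hV0 hκpos hGB B hB0 hB hα hrow hcol
    hρ hθ hcc0 hrow' hcol' hN₀ p_1 J hp_1 τ'' w''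

/-! ## §3 Term 4: the increment smeared by the dressed soft line, first order -/

/-- **TERM 4 OF THE CARRIER SPLIT — `e^{Δ_D}I_Λ − I_Λ` through the binomial prescribed door, all line data discharged** (`D = C∞ − C_Λ =
normalCovariance (klE5SoftLineSym … Λ)`, soft shape `A_p = 8`, support `{ρ_K ≤ Λ_{n−1}}`; input pair = point-augmented level `n−3`, output level `n−2`,
Gram constant `√(8·Cκ·e₀·8^{−(n−3)})`; the increment `I_Λ = effAction C_Λ V − e^{Δ_{C_Λ}}V` is even since `V` is even and constant-free, `Z^{K_n}_{Λ_{n−1}} ≠ 0`).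
Remaining hypotheses: the prescribed sizes `B` of `I_Λ` at level `n−3` (= §2 at `J′ = n−3`, summed in part 4) and the overlap rows `(cr, cc)`.
[cite: BenfattoGiulianiMastropietro2006, §2.8 (2.80)] -/
theorem carrier_smearSoft_firstOrder_le :
    ∃ Cκ : ℝ, 0 < Cκ ∧ ∀ (P : SplitConsts) (R : RenConsts) (c : ℝ), P.WF → R.WF2 → 0 < c → c ≤ klEngC₃3 P R →
      ∀ μ ∈ klWindowC, ∀ U : ℝ, 0 < U → U ≤ klEngU₀4 P R c → ∀ β : ℝ, klBetaMin ≤ β → β ≤ Real.exp (c / U ^ 2) →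
      ∀ (L M : ℕ) [NeZero L] [NeZero M], klEngL₃ β U ≤ L → klEngM₃ β U L ≤ M →
      ∀ n : ℕ, 4 ≤ n → n ≤ nScales β + 1 → FrameOK R U (nScales β) μ (klFlowFrameU L M β U μ n) →
      hubbardEffPartitionFnCT L M β U μ 0 (klFlowFrameU L M β U μ n) (klScale klE0 (n - 1)) ≠ 0 →
      ∀ Λ ∈ Set.Icc (klScale klE0 n) (klScale klE0 (n - 1)),
      (∀ ks : FreqMomentum L M × Fin 2,
        ‖klE5SliceSym L M β μ (klFlowFrameU L M β U μ n) (n - 1) (klScale klE0 n) ks * klE5Kappa L M β U μ (klFlowFrameU L M β U μ n) (n - 1) ks‖ ≤ 1 / 2 ∧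
        ‖klE5SliceSym L M β μ (klFlowFrameU L M β U μ n) (n - 1) Λ ks * klE5Kappa L M β U μ (klFlowFrameU L M β U μ n) (n - 1) ks‖ ≤ 1 / 2) →
      ∀ (Qm : TorusSite 2 L) (x y : TorusSite 2 L × MatsubaraIdx M) (B : ℕ → ℕ → ℝ), (∀ m' Fc, 0 ≤ B m' Fc) →
      (∀ (m' Fc : ℕ) (E : Finset (Fin (2 * m' + 1 + 1))) (τ : Fin (2 * m' + 1 + 1) → SectorLeg (sectorCount (n - 3) + 4))
        (q : Fin (2 * m' + 1 + 1)), q ∈ E → E.card = Fc + 1 → ∀ ys : SpaceTimeIdx L M,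
          imagTimeWeight β M ^ (2 * m' + 1) *
            ∑ σ ∈ univ.filter (fun σ : Fin (2 * m' + 1 + 1) → SectorLeg (sectorCount (n - 3) + 4) => ∀ e ∈ E, σ e = τ e),
              ∑ xs ∈ univ.filter (fun xs : Fin (2 * m' + 1 + 1) → SpaceTimeIdx L M => xs q = ys),
                ‖sectorisedKernel L M β (pointAugment (klAnisoFamily L M β μ (klFlowFrameU L M β U μ n) klE0 (n - 3)) (klE5ExtMomenta Qm x y))
                  (effAction ℂ (klE5DressedSlice L M β μ (klFlowFrameU L M β U μ n) (n - 1) (klE5Kappa L M β U μ (klFlowFrameU L M β U μ n) (n - 1)) Λ)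
                      (klE5Input L M β U μ (klFlowFrameU L M β U μ n) (n - 1)) -
                    gaussConv ℂ (klE5DressedSlice L M β μ (klFlowFrameU L M β U μ n) (n - 1) (klE5Kappa L M β U μ (klFlowFrameU L M β U μ n) (n - 1)) Λ)
                      (klE5Input L M β U μ (klFlowFrameU L M β U μ n) (n - 1)))
                  (2 * m' + 1 + 1) σ xs‖ ≤ B (m' + 1) Fc) →
      ∀ {cr cc : ℝ}, 0 ≤ cc →
      (∀ X'', ∑ X', ‖(sectorAnalysisMatrix L M β (pointAugment (klAnisoFamily L M β μ (klFlowFrameU L M β U μ n) klE0 (n - 2)) (klE5ExtMomenta Qm x y)) *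
          sectorSubMatrix L M β (pointAugmentFat (klAnisoFamily L M β μ (klFlowFrameU L M β U μ n) klE0 (n - 3))
            (bgmFatMultiplier L M klE0 β (nambuXiCT L μ (klFlowFrameU L M β U μ n)) (n - 3)) (klE5ExtMomenta Qm x y))) X'' X'‖ ≤ cr) →
      (∀ X', ∑ X'', ‖(sectorAnalysisMatrix L M β (pointAugment (klAnisoFamily L M β μ (klFlowFrameU L M β U μ n) klE0 (n - 2)) (klE5ExtMomenta Qm x y)) *
          sectorSubMatrix L M β (pointAugmentFat (klAnisoFamily L M β μ (klFlowFrameU L M β U μ n) klE0 (n - 3))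
            (bgmFatMultiplier L M klE0 β (nambuXiCT L μ (klFlowFrameU L M β U μ n)) (n - 3)) (klE5ExtMomenta Qm x y))) X'' X'‖ ≤ cc) →
      ∀ {q : ℕ} (i : Fin (2 * q + 1 + 1)) (J : Finset (Fin (2 * q + 1 + 1))), i ∉ J →
      ∀ (τ'' : Fin (2 * q + 1 + 1) → SectorLeg (sectorCount (n - 2) + 4)) (w'' : SpaceTimeIdx L M × SectorLeg (sectorCount (n - 2) + 4)),
      ∑ X'' ∈ univ.filter (fun X'' : Fin (2 * q + 1 + 1) → SpaceTimeIdx L M × SectorLeg (sectorCount (n - 2) + 4) =>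
          X'' i = w'' ∧ ∀ j ∈ J, (X'' j).2 = τ'' j),
        ‖kernel ℂ (ExteriorAlgebra.map (Matrix.toLin' (sectorAnalysisMatrix L M β
            (pointAugment (klAnisoFamily L M β μ (klFlowFrameU L M β U μ n) klE0 (n - 2)) (klE5ExtMomenta Qm x y))))
          (gaussConv ℂ (klE5Total L M β μ (klFlowFrameU L M β U μ n) (n - 1) (klE5Kappa L M β U μ (klFlowFrameU L M β U μ n) (n - 1)) -
                klE5DressedSlice L M β μ (klFlowFrameU L M β U μ n) (n - 1) (klE5Kappa L M β U μ (klFlowFrameU L M β U μ n) (n - 1)) Λ)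
              (effAction ℂ (klE5DressedSlice L M β μ (klFlowFrameU L M β U μ n) (n - 1) (klE5Kappa L M β U μ (klFlowFrameU L M β U μ n) (n - 1)) Λ)
                  (klE5Input L M β U μ (klFlowFrameU L M β U μ n) (n - 1)) -
                gaussConv ℂ (klE5DressedSlice L M β μ (klFlowFrameU L M β U μ n) (n - 1) (klE5Kappa L M β U μ (klFlowFrameU L M β U μ n) (n - 1)) Λ)
                  (klE5Input L M β U μ (klFlowFrameU L M β U μ n) (n - 1))) -
            (effAction ℂ (klE5DressedSlice L M β μ (klFlowFrameU L M β U μ n) (n - 1) (klE5Kappa L M β U μ (klFlowFrameU L M β U μ n) (n - 1)) Λ)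
                (klE5Input L M β U μ (klFlowFrameU L M β U μ n) (n - 1)) -
              gaussConv ℂ (klE5DressedSlice L M β μ (klFlowFrameU L M β U μ n) (n - 1) (klE5Kappa L M β U μ (klFlowFrameU L M β U μ n) (n - 1)) Λ)
                (klE5Input L M β U μ (klFlowFrameU L M β U μ n) (n - 1))))) (2 * q + 1 + 1) X''‖ ≤
      cr * cc ^ (2 * q + 1) *
        ∑ m' ∈ range (Fintype.card (SpaceTimeIdx L M × SectorLeg (sectorCount (n - 3) + 4)) / 2 + 1), (if q + 1 < m' then
          ((((2 * (q + 1)).factorial : ℝ))⁻¹ * ((∏ j ∈ univ.filter (fun j : Fin (2 * (q + 1)) => j ∉ J), (2 * m' - (j : ℕ)) : ℕ) : ℝ)) *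
            ((2 * m' : ℕ) : ℝ) ^ J.card * Real.sqrt (8 * Cκ * (klE0 * ((8 : ℝ) ^ (n - 3))⁻¹)) ^ (2 * m' - 2 * (q + 1)) *
              (((36 + 4 : ℕ) : ℝ) ^ J.card * (imagTimeWeight β M * B m' J.card)) else 0) := by
  obtain ⟨Cκ, hCκ, hpkg⟩ := gram_softShaped_pointAugmentFat_klEng
  refine ⟨Cκ, hCκ, ?_⟩
  intro P R c hP hR hc hc3 μ hμ U hU hU4 β hβ hβc L M _ _ hL hM n hn4 hnN hF hZ Λ hΛ hsm Qm x y B hB0 hB cr cc hcc0 hrow' hcol' q i J hi τ'' w''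
  -- abbreviations
  set K := klFlowFrameU L M β U μ n with hK
  set κ := klE5Kappa L M β U μ K (n - 1) with hκ
  set e := klE5ExtMomenta (L := L) (M := M) Qm x y with he
  set V := klE5Input L M β U μ K (n - 1) with hV
  set p : FreqMomentum L M × Fin 2 → ℂ := klE5SoftLineSym L M β μ K (n - 1) κ Λ with hp
  have he₀ : (0 : ℝ) ≤ klE0 := by norm_num [klE0]
  have hβ0 : 0 < β := lt_of_lt_of_le (by norm_num [klBetaMin]) hβ
  have hn1 : n - 1 + 1 = n := by omega
  have hΛpos : 0 < Λ := lt_of_lt_of_le (klth_klScale_pos n) hΛ.1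
  -- the dressed soft symbol: soft shape `A_p = 8` and support `ρ_K ≤ Λ_{n−1}`
  have hshape : ∀ ks, p ks ≠ 0 → ‖p ks‖ ≤ 8 * (β * (L : ℝ) ^ 2) / Real.sqrt (matsubaraFreq β M ks.1.1 ^ 2 + nambuXiCT L μ K ks.1.2 ^ 2) := by
    intro ks _
    have h1 : ‖klE5SliceSym L M β μ K (n - 1) (klScale klE0 (n - 1 + 1)) ks * κ ks‖ ≤ 1 / 2 := by rw [hn1]; exact (hsm ks).1
    exact norm_klE5SoftLineSym_le_div_radius β μ K (n - 1) κ hβ0.le ks h1 (hsm ks).2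
  have hsupp : ∀ ks, p ks ≠ 0 → Real.sqrt (matsubaraFreq β M ks.1.1 ^ 2 + nambuXiCT L μ K ks.1.2 ^ 2) ≤ klScale klE0 (n - 1) :=
    fun ks hks => klRadius_le_of_klE5SoftLineSym_ne_zero (L := L) (M := M) (β := β) κ μ K (n - 1) hΛpos hΛ.2 ks hks
  have hsuppPkg : ∀ ks, p ks ≠ 0 → Real.sqrt (matsubaraFreq β M ks.1.1 ^ 2 + nambuXiCT L μ K ks.1.2 ^ 2) ≤ klScale klE0 (n - 3 + 1) :=
    fun ks hks => (hsupp ks hks).trans (klScale_le_klScale he₀ (by omega))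
  have hsuppDoor : ∀ ks, p ks ≠ 0 → Real.sqrt (matsubaraFreq β M ks.1.1 ^ 2 + nambuXiCT L μ K ks.1.2 ^ 2) ≤ klScale klE0 (n - 2) :=
    fun ks hks => (hsupp ks hks).trans (klScale_le_klScale he₀ (by omega))
  -- the Gram datum on the point-augmented fat family of level `n−3`
  obtain ⟨-, -, -, hGB, -⟩ := hpkg P R c hP hR hc hc3 μ hμ U hU hU4 β hβ hβc K hF L M hL hM (n - 3) (by omega) (by omega) p 8 (by norm_num)
    hshape hsuppPkg e
  -- the identity `D = normalCovariance p` and the parity of the increment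
  have hD : klE5Total L M β μ K (n - 1) κ - klE5DressedSlice L M β μ K (n - 1) κ Λ = normalCovariance L M p :=
    klE5Total_sub_dressedSlice_eq_normalCovariance L M β μ K (n - 1) κ Λ
  have hVe : V ∈ evenPart ℂ (HubbardFieldIdx L M) := klE5Input_mem_evenPart β U μ K (n - 1) hβ0.ne'
  have hV0 : constPart ℂ V = 0 := constPart_klE5Input_eq_zero β U μ K (n - 1) hZ
  have hI : effAction ℂ (klE5DressedSlice L M β μ K (n - 1) κ Λ) V - gaussConv ℂ (klE5DressedSlice L M β μ K (n - 1) κ Λ) V ∈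
      evenPart ℂ (HubbardFieldIdx L M) :=
    sub_mem (effAction_mem_evenPart _ hVe hV0) (mem_evenPart_iff.2 (gaussConv_mem_evenOdd ℂ _ (mem_evenPart_iff.1 hVe)))
  rw [hD]
  exact carrierStep_firstOrder_lev_le hβ0 μ K (J₁ := n - 2) (J' := n - 2) (by omega) le_rfl e p hsuppDoor _ hI (Real.sqrt_nonneg _) hGB
    B hB0 hB hcc0 hrow' hcol' i J hi τ'' w''

end Summit.HubbardSuperconductivity.HubbardSuperconductivity.Theorems.KLRegimeSplit

end
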